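import Mathlib
import Summits.AtomisticToContinuum.HydrodynamicLimit.Theorems.ImplosionDichotomyDenseExcursionCavityODE
import Summits.AtomisticToContinuum.HydrodynamicLimit.Theorems.ImplosionDichotomyDenseExcursionSonicCavityDefs
import Summits.AtomisticToContinuum.HydrodynamicLimit.Theorems.ImplosionDichotomyDenseExcursionSonicSmoothBranchCk

/-!
# Exterior continuation of centre-regular solutions of the resolvent equation (theorem T5)
# (crux `DenseExcursion`, line `sonic-cavity-renewal`, brick for stub `stub_cavityResolventCk`)

Helper file (`--supports stmt-AtomisticToContinuum-12586`, line lead a2, stub-worker E for `stub_cavityResolventCk`).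
THEOREM T5 of the decomposition of `stub_cavityResolventCk` (registered helper `exterior_continuation`): for a monatomic
profile in the cavity tube, `Λ : ℂ`, smooth sources `f, g` and a regular pair `(ŵ₀, ŝ₀)` (`IsRegularPair`) solving the
resolvent equation `Λŵ − linW = f`, `Λŝ − linS = g` on `x ≤ 1`, there is a regular pair `(ŵ, ŝ)` solving it on ALL of `ℝ`
and agreeing with `(ŵ₀, ŝ₀)` on `x ≤ 1`.

Mechanism. On `x > 0` the tube's subsonic clause `W + S < 1` and `S > 0` make both characteristic speeds
`c₊ = W − 1 + S`, `c₋ = W − 1 − S` negative, so in the characteristic fields `p = ŵ + 3ŝ`, `q = ŵ − 3ŝ` (`lin_iff_char`)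
the resolvent equation is the REGULAR affine `2 × 2` system `p′ = ((Λ − b₊₊)p − b₊₋q − (f+3g))/c₊`,
`q′ = (−b₋₊p + (Λ − b₋₋)q − (f−3g))/c₋` with `C^∞` coefficients on `x > 0`. Clamping the argument of the coefficients at
`x = 1/8` gives globally continuous coefficients, so `exists_affine_solution_two` (file `…CavityODE`) provides a global `C¹`
solution through the data of `(ŵ₀, ŝ₀)` at `x = 1/2`, smooth on `x > 1/8`; by `eqOn_of_affine_solution_two` it agrees with
`(ŵ₀ + 3ŝ₀, ŵ₀ − 3ŝ₀)` on `(1/8, 1)`, hence on `[1/8, 1]`. The glued pair (`ŵ₀` on `x ≤ 3/4`, the continuation beyond) is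
locally one of the two smooth solutions everywhere, so it is `C^∞` and solves on `ℝ`; it is a regular pair by
`isRegularPair_of_eqOn` (the centre germ is that of `(ŵ₀, ŝ₀)`). Only `IsMonatomicProfile` (smoothness, `S > 0`) and
clause (a) `∀ x > 0, W + S < 1` of `CavityTube` are used. Sources: folklore (Hartman Ch. IV Lemma 1.1).
-/

noncomputable section

open Set Filter
open scoped Topology ContDiff

namespace Summit.AtomisticToContinuum.HydrodynamicLimit.Theorems.SonicCavityRenewal

open Summit.AtomisticToContinuum.HydrodynamicLimit.Theorems.R2OneModeTwoConditions

/-- `linW`, `linS` at `x` depend only on the germs of `(ŵ, ŝ)` at `x`. [folklore] -/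
theorem lin_congr_of_eventuallyEq {r : ℝ} {W S : ℝ → ℝ} {ŵ ŝ ŵ' ŝ' : ℝ → ℂ} {x : ℝ} (hw : ŵ =ᶠ[𝓝 x] ŵ')
    (hs : ŝ =ᶠ[𝓝 x] ŝ') :
    linW r W S ŵ ŝ x = linW r W S ŵ' ŝ' x ∧ linS r W S ŵ ŝ x = linS r W S ŵ' ŝ' x := by
  simp only [linW, linS, hw.deriv_eq, hs.deriv_eq, hw.eq_of_nhds, hs.eq_of_nhds, and_self]

/-- Solving `c · D = R` for `D` when `c ≠ 0`. [folklore] -/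
theorem eq_inv_mul_of_mul_eq_left {c D R : ℂ} (hc : c ≠ 0) (h : c * D = R) : D = c⁻¹ * R := by
  rw [← h, ← mul_assoc, inv_mul_cancel₀ hc, one_mul]

/-- **Registered helper `exterior_continuation` (T5): EXTERIOR CONTINUATION OF CENTRE-REGULAR SOLUTIONS OF THE RESOLVENT
EQUATION.** For a monatomic profile in the cavity tube, `Λ : ℂ`, `C^∞` sources `f, g` and a regular pair `(ŵ₀, ŝ₀)` solving
`Λŵ − linW = f`, `Λŝ − linS = g` on `x ≤ 1`, there is a regular pair solving the equations on all of `ℝ` and agreeing with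
`(ŵ₀, ŝ₀)` on `x ≤ 1` (regular affine ODE in characteristic variables on `x > 0`, where `c± = W − 1 ± S < 0`; see the
module docstring). [folklore] -/
theorem exterior_continuation : ∀ (r : ℝ) (W S : ℝ → ℝ), IsMonatomicProfile r W S → CavityTube r W S → ∀ (Λ : ℂ) (f g ŵ₀ ŝ₀ : ℝ → ℂ), ContDiff ℝ ∞ f → ContDiff ℝ ∞ g → IsRegularPair ŵ₀ ŝ₀ → (∀ x ∈ Set.Iic (1 : ℝ), Λ * ŵ₀ x - linW r W S ŵ₀ ŝ₀ x = f x ∧ Λ * ŝ₀ x - linS r W S ŵ₀ ŝ₀ x = g x) → ∃ ŵ ŝ : ℝ → ℂ, IsRegularPair ŵ ŝ ∧ (∀ x, Λ * ŵ x - linW r W S ŵ ŝ x = f x ∧ Λ * ŝ x - linS r W S ŵ ŝ x = g x) ∧ Set.EqOn ŵ ŵ₀ (Set.Iic 1) ∧ Set.EqOn ŝ ŝ₀ (Set.Iic 1) := by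
  intro r W S hP hT Λ f g ŵ₀ ŝ₀ hf hg h₀ hsol
  obtain ⟨-, -, hW, hS, hSpos, -⟩ := hP
  obtain ⟨-, -, hsub, -⟩ := hT
  have hŵ₀ : ContDiff ℝ ∞ ŵ₀ := h₀.1
  have hŝ₀ : ContDiff ℝ ∞ ŝ₀ := h₀.2.1
  have hW' : ContDiff ℝ ∞ (deriv W) := (contDiff_infty_iff_deriv.1 hW).2
  have hS' : ContDiff ℝ ∞ (deriv S) := (contDiff_infty_iff_deriv.1 hS).2
  -- the eight smooth data of the characteristic form, as opaque functions with defining equations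
  obtain ⟨Cp, hCp⟩ : ∃ C : ℝ → ℂ, C = fun x => ((W x - 1 + S x : ℝ) : ℂ) := ⟨_, rfl⟩
  obtain ⟨Cm, hCm⟩ : ∃ C : ℝ → ℂ, C = fun x => ((W x - 1 - S x : ℝ) : ℂ) := ⟨_, rfl⟩
  obtain ⟨Bpp, hBpp⟩ : ∃ B : ℝ → ℂ,
      B = fun x => ((2 / 3 * deriv W x + 2 * W x - r + 2 * deriv S x + 4 * S x : ℝ) : ℂ) := ⟨_, rfl⟩
  obtain ⟨Bpm, hBpm⟩ : ∃ B : ℝ → ℂ, B = fun x => ((deriv W x / 3 + deriv S x + 2 * S x : ℝ) : ℂ) := ⟨_, rfl⟩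
  obtain ⟨Bmp, hBmp⟩ : ∃ B : ℝ → ℂ, B = fun x => ((deriv W x / 3 - deriv S x - 2 * S x : ℝ) : ℂ) := ⟨_, rfl⟩
  obtain ⟨Bmm, hBmm⟩ : ∃ B : ℝ → ℂ,
      B = fun x => ((2 / 3 * deriv W x + 2 * W x - r - 2 * deriv S x - 4 * S x : ℝ) : ℂ) := ⟨_, rfl⟩
  obtain ⟨σp, hσp⟩ : ∃ s : ℝ → ℂ, s = fun x => f x + 3 * g x := ⟨_, rfl⟩
  obtain ⟨σq, hσq⟩ : ∃ s : ℝ → ℂ, s = fun x => f x - 3 * g x := ⟨_, rfl⟩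
  have sCp : ContDiff ℝ ∞ Cp := by
    rw [hCp]; exact Complex.ofRealCLM.contDiff.comp ((hW.sub contDiff_const).add hS)
  have sCm : ContDiff ℝ ∞ Cm := by
    rw [hCm]; exact Complex.ofRealCLM.contDiff.comp ((hW.sub contDiff_const).sub hS)
  have sBpp : ContDiff ℝ ∞ Bpp := by
    rw [hBpp]
    exact Complex.ofRealCLM.contDiff.comp (((((contDiff_const.mul hW').add (contDiff_const.mul hW)).sub
      contDiff_const).add (contDiff_const.mul hS')).add (contDiff_const.mul hS))
  have sBpm : ContDiff ℝ ∞ Bpm := by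
    rw [hBpm]
    exact Complex.ofRealCLM.contDiff.comp (((hW'.div_const 3).add hS').add (contDiff_const.mul hS))
  have sBmp : ContDiff ℝ ∞ Bmp := by
    rw [hBmp]
    exact Complex.ofRealCLM.contDiff.comp (((hW'.div_const 3).sub hS').sub (contDiff_const.mul hS))
  have sBmm : ContDiff ℝ ∞ Bmm := by
    rw [hBmm]
    exact Complex.ofRealCLM.contDiff.comp (((((contDiff_const.mul hW').add (contDiff_const.mul hW)).sub
      contDiff_const).sub (contDiff_const.mul hS')).sub (contDiff_const.mul hS))
  have sσp : ContDiff ℝ ∞ σp := by rw [hσp]; exact hf.add (contDiff_const.mul hg)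
  have sσq : ContDiff ℝ ∞ σq := by rw [hσq]; exact hf.sub (contDiff_const.mul hg)
  -- both characteristic speeds are negative on `x > 0`
  have Cp0 : ∀ x, 0 < x → Cp x ≠ 0 := fun x hx => by
    have h : W x - 1 + S x < 0 := by linarith [hsub x hx]
    simp only [hCp, ne_eq, Complex.ofReal_eq_zero]
    exact h.ne
  have Cm0 : ∀ x, 0 < x → Cm x ≠ 0 := fun x hx => by
    have h : W x - 1 - S x < 0 := by linarith [hsub x hx, hSpos x]
    simp only [hCm, ne_eq, Complex.ofReal_eq_zero]
    exact h.ne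
  -- the clamp and the clamped coefficients (globally continuous, equal to the true ones on `x > 1/8`)
  set κ : ℝ → ℝ := fun t => max t (1 / 8) with hκ
  have hκc : Continuous κ := continuous_id.max continuous_const
  have hκpos : ∀ t, 0 < κ t := fun t => lt_of_lt_of_le (by norm_num) (le_max_right t (1 / 8))
  have hκid : ∀ t ∈ Ioi (1 / 8 : ℝ), κ t = t := fun t ht => max_eq_left (le_of_lt ht)
  have Upos : ∀ t ∈ Ioi (1 / 8 : ℝ), 0 < t := fun t ht => lt_trans (by norm_num) ht
  have hU : IsOpen (Ioi (1 / 8 : ℝ)) := isOpen_Ioi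
  set a₁₁ : ℝ → ℂ := fun t => (Λ - Bpp (κ t)) * (Cp (κ t))⁻¹ with ha₁₁
  set a₁₂ : ℝ → ℂ := fun t => -Bpm (κ t) * (Cp (κ t))⁻¹ with ha₁₂
  set b₁ : ℝ → ℂ := fun t => -σp (κ t) * (Cp (κ t))⁻¹ with hb₁
  set a₂₁ : ℝ → ℂ := fun t => -Bmp (κ t) * (Cm (κ t))⁻¹ with ha₂₁
  set a₂₂ : ℝ → ℂ := fun t => (Λ - Bmm (κ t)) * (Cm (κ t))⁻¹ with ha₂₂
  set b₂ : ℝ → ℂ := fun t => -σq (κ t) * (Cm (κ t))⁻¹ with hb₂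
  have cinvp : Continuous fun t => (Cp (κ t))⁻¹ := (sCp.continuous.comp hκc).inv₀ fun t => Cp0 _ (hκpos t)
  have cinvm : Continuous fun t => (Cm (κ t))⁻¹ := (sCm.continuous.comp hκc).inv₀ fun t => Cm0 _ (hκpos t)
  have ca₁₁ : Continuous a₁₁ := (continuous_const.sub (sBpp.continuous.comp hκc)).mul cinvp
  have ca₁₂ : Continuous a₁₂ := (sBpm.continuous.comp hκc).neg.mul cinvp
  have cb₁ : Continuous b₁ := (sσp.continuous.comp hκc).neg.mul cinvp
  have ca₂₁ : Continuous a₂₁ := (sBmp.continuous.comp hκc).neg.mul cinvm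
  have ca₂₂ : Continuous a₂₂ := (continuous_const.sub (sBmm.continuous.comp hκc)).mul cinvm
  have cb₂ : Continuous b₂ := (sσq.continuous.comp hκc).neg.mul cinvm
  have sinvp : ContDiffOn ℝ ∞ (fun t => (Cp t)⁻¹) (Ioi (1 / 8)) := sCp.contDiffOn.inv fun t ht => Cp0 t (Upos t ht)
  have sinvm : ContDiffOn ℝ ∞ (fun t => (Cm t)⁻¹) (Ioi (1 / 8)) := sCm.contDiffOn.inv fun t ht => Cm0 t (Upos t ht)
  have sa₁₁ : ContDiffOn ℝ ∞ a₁₁ (Ioi (1 / 8)) :=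
    (((contDiffOn_const (c := Λ)).sub sBpp.contDiffOn).mul sinvp).congr fun t ht => by simp only [ha₁₁, hκid t ht]
  have sa₁₂ : ContDiffOn ℝ ∞ a₁₂ (Ioi (1 / 8)) :=
    (sBpm.contDiffOn.neg.mul sinvp).congr fun t ht => by simp only [ha₁₂, hκid t ht]
  have sb₁ : ContDiffOn ℝ ∞ b₁ (Ioi (1 / 8)) :=
    (sσp.contDiffOn.neg.mul sinvp).congr fun t ht => by simp only [hb₁, hκid t ht]
  have sa₂₁ : ContDiffOn ℝ ∞ a₂₁ (Ioi (1 / 8)) :=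
    (sBmp.contDiffOn.neg.mul sinvm).congr fun t ht => by simp only [ha₂₁, hκid t ht]
  have sa₂₂ : ContDiffOn ℝ ∞ a₂₂ (Ioi (1 / 8)) :=
    (((contDiffOn_const (c := Λ)).sub sBmm.contDiffOn).mul sinvm).congr fun t ht => by simp only [ha₂₂, hκid t ht]
  have sb₂ : ContDiffOn ℝ ∞ b₂ (Ioi (1 / 8)) :=
    (sσq.contDiffOn.neg.mul sinvm).congr fun t ht => by simp only [hb₂, hκid t ht]
  -- the global `C¹` solution of the clamped system through the data of `(ŵ₀, ŝ₀)` at `x = 1/2`, smooth on `x > 1/8`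
  obtain ⟨p, q, hp0, hq0, hpq, hsmooth⟩ := exists_affine_solution_two a₁₁ a₁₂ a₂₁ a₂₂ b₁ b₂ ca₁₁ ca₁₂ ca₂₁ ca₂₂ cb₁ cb₂
    (1 / 2) (ŵ₀ (1 / 2) + 3 * ŝ₀ (1 / 2)) (ŵ₀ (1 / 2) - 3 * ŝ₀ (1 / 2))
  obtain ⟨sp, sq⟩ := hsmooth _ hU sa₁₁ sa₁₂ sa₂₁ sa₂₂ sb₁ sb₂
  -- the given pair, in characteristic variables, solves the same system on `(1/8, 1)`
  have hd₀ : ∀ x, HasDerivAt ŵ₀ (deriv ŵ₀ x) x := fun x => (hŵ₀.differentiable (by simp) x).hasDerivAt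
  have hd₀' : ∀ x, HasDerivAt ŝ₀ (deriv ŝ₀ x) x := fun x => (hŝ₀.differentiable (by simp) x).hasDerivAt
  have hV₀ : ∀ t ∈ Ioo (1 / 8 : ℝ) 1,
      HasDerivAt (fun x => ŵ₀ x + 3 * ŝ₀ x) (a₁₁ t * (ŵ₀ t + 3 * ŝ₀ t) + a₁₂ t * (ŵ₀ t - 3 * ŝ₀ t) + b₁ t) t ∧
      HasDerivAt (fun x => ŵ₀ x - 3 * ŝ₀ x) (a₂₁ t * (ŵ₀ t + 3 * ŝ₀ t) + a₂₂ t * (ŵ₀ t - 3 * ŝ₀ t) + b₂ t) t := by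
    intro t ht
    have ht8 : t ∈ Ioi (1 / 8 : ℝ) := ht.1
    have htpos : 0 < t := Upos t ht8
    obtain ⟨e1, e2⟩ := (lin_iff_char r W S Λ ŵ₀ ŝ₀ (f t) (g t) t).1 (hsol t (le_of_lt ht.2))
    have e1' : Cp t * (deriv ŵ₀ t + 3 * deriv ŝ₀ t) =
        (Λ - Bpp t) * (ŵ₀ t + 3 * ŝ₀ t) - Bpm t * (ŵ₀ t - 3 * ŝ₀ t) - σp t := by
      simp only [hCp, hBpp, hBpm, hσp]; exact e1
    have e2' : Cm t * (deriv ŵ₀ t - 3 * deriv ŝ₀ t) =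
        -Bmp t * (ŵ₀ t + 3 * ŝ₀ t) + (Λ - Bmm t) * (ŵ₀ t - 3 * ŝ₀ t) - σq t := by
      simp only [hCm, hBmp, hBmm, hσq]; exact e2
    have hc1 : Cp t ≠ 0 := Cp0 t htpos
    have hc2 : Cm t ≠ 0 := Cm0 t htpos
    constructor
    · have hD : HasDerivAt (fun x => ŵ₀ x + 3 * ŝ₀ x) (deriv ŵ₀ t + 3 * deriv ŝ₀ t) t :=
        (hd₀ t).add ((hd₀' t).const_mul 3)
      convert hD using 1
      rw [eq_inv_mul_of_mul_eq_left hc1 e1']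
      simp only [ha₁₁, ha₁₂, hb₁, hκid t ht8]
      ring
    · have hD : HasDerivAt (fun x => ŵ₀ x - 3 * ŝ₀ x) (deriv ŵ₀ t - 3 * deriv ŝ₀ t) t :=
        (hd₀ t).sub ((hd₀' t).const_mul 3)
      convert hD using 1
      rw [eq_inv_mul_of_mul_eq_left hc2 e2']
      simp only [ha₂₁, ha₂₂, hb₂, hκid t ht8]
      ring
  -- uniqueness on `(1/8, 1)`, then on `[1/8, 1]` by continuity
  obtain ⟨ep, eq'⟩ := eqOn_of_affine_solution_two a₁₁ a₁₂ a₂₁ a₂₂ b₁ b₂ (1 / 8) 1 (1 / 2) ⟨by norm_num, by norm_num⟩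
    ca₁₁.continuousOn ca₁₂.continuousOn ca₂₁.continuousOn ca₂₂.continuousOn p q (fun x => ŵ₀ x + 3 * ŝ₀ x)
    (fun x => ŵ₀ x - 3 * ŝ₀ x) (fun t _ => hpq t) hV₀ (by rw [hp0]) (by rw [hq0])
  have pc : Continuous p := continuous_iff_continuousAt.2 fun t => (hpq t).1.continuousAt
  have qc : Continuous q := continuous_iff_continuousAt.2 fun t => (hpq t).2.continuousAt
  have hcl : closure (Ioo (1 / 8 : ℝ) 1) = Icc (1 / 8) 1 := closure_Ioo (by norm_num)
  have epc : EqOn p (fun x => ŵ₀ x + 3 * ŝ₀ x) (Icc (1 / 8) 1) := by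
    rw [← hcl]; exact ep.closure pc (hŵ₀.continuous.add (continuous_const.mul hŝ₀.continuous))
  have eqc : EqOn q (fun x => ŵ₀ x - 3 * ŝ₀ x) (Icc (1 / 8) 1) := by
    rw [← hcl]; exact eq'.closure qc (hŵ₀.continuous.sub (continuous_const.mul hŝ₀.continuous))
  -- back to `(ŵ, ŝ)` on the exterior side
  set ŵ₁ : ℝ → ℂ := fun x => (p x + q x) / 2 with hŵ₁
  set ŝ₁ : ℝ → ℂ := fun x => (p x - q x) / 6 with hŝ₁
  have e₁ : EqOn ŵ₁ ŵ₀ (Icc (1 / 8) 1) := fun x hx => by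
    simp only [hŵ₁, epc hx, eqc hx]; ring
  have e₂ : EqOn ŝ₁ ŝ₀ (Icc (1 / 8) 1) := fun x hx => by
    simp only [hŝ₁, epc hx, eqc hx]; ring
  have sŵ₁ : ContDiffOn ℝ ∞ ŵ₁ (Ioi (1 / 8)) := (sp.add sq).div_const 2
  have sŝ₁ : ContDiffOn ℝ ∞ ŝ₁ (Ioi (1 / 8)) := (sp.sub sq).div_const 6
  have hsol₁ : ∀ x ∈ Ioi (1 / 8 : ℝ), Λ * ŵ₁ x - linW r W S ŵ₁ ŝ₁ x = f x ∧ Λ * ŝ₁ x - linS r W S ŵ₁ ŝ₁ x = g x := by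
    intro x hx
    have hxpos : 0 < x := Upos x hx
    obtain ⟨h1, h2⟩ := hpq x
    have hD1 : HasDerivAt ŵ₁ ((_ + _) / 2) x := (h1.add h2).div_const 2
    have hD2 : HasDerivAt ŝ₁ ((_ - _) / 6) x := (h1.sub h2).div_const 6
    have hinvp : Cp x * (Cp x)⁻¹ = 1 := mul_inv_cancel₀ (Cp0 x hxpos)
    have hinvm : Cm x * (Cm x)⁻¹ = 1 := mul_inv_cancel₀ (Cm0 x hxpos)
    refine (lin_iff_char r W S Λ ŵ₁ ŝ₁ (f x) (g x) x).2 ⟨?_, ?_⟩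
    · have goal : Cp x * (deriv ŵ₁ x + 3 * deriv ŝ₁ x) =
          (Λ - Bpp x) * (ŵ₁ x + 3 * ŝ₁ x) - Bpm x * (ŵ₁ x - 3 * ŝ₁ x) - σp x := by
        rw [hD1.deriv, hD2.deriv]
        simp only [ha₁₁, ha₁₂, hb₁, hκid x hx, hŵ₁, hŝ₁]
        linear_combination ((Λ - Bpp x) * p x - Bpm x * q x - σp x) * hinvp
      simp only [hCp, hBpp, hBpm, hσp] at goal
      exact goal
    · have goal : Cm x * (deriv ŵ₁ x - 3 * deriv ŝ₁ x) =
          -Bmp x * (ŵ₁ x + 3 * ŝ₁ x) + (Λ - Bmm x) * (ŵ₁ x - 3 * ŝ₁ x) - σq x := by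
        rw [hD1.deriv, hD2.deriv]
        simp only [ha₂₁, ha₂₂, hb₂, hκid x hx, hŵ₁, hŝ₁]
        linear_combination (-Bmp x * p x + (Λ - Bmm x) * q x - σq x) * hinvm
      simp only [hCm, hBmp, hBmm, hσq] at goal
      exact goal
  -- gluing at `x = 3/4`: the glued pair is locally one of the two smooth solutions everywhere
  set ŵ : ℝ → ℂ := fun x => if x ≤ 3 / 4 then ŵ₀ x else ŵ₁ x with hŵ
  set ŝ : ℝ → ℂ := fun x => if x ≤ 3 / 4 then ŝ₀ x else ŝ₁ x with hŝ
  have heqw : EqOn ŵ ŵ₀ (Iic 1) := fun x hx => by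
    by_cases h : x ≤ 3 / 4
    · simp only [hŵ, if_pos h]
    · simp only [hŵ, if_neg h]
      exact e₁ ⟨by linarith [not_le.1 h], hx⟩
  have heqs : EqOn ŝ ŝ₀ (Iic 1) := fun x hx => by
    by_cases h : x ≤ 3 / 4
    · simp only [hŝ, if_pos h]
    · simp only [hŝ, if_neg h]
      exact e₂ ⟨by linarith [not_le.1 h], hx⟩
  have heqw₁ : EqOn ŵ ŵ₁ (Ioi (1 / 8)) := fun x hx => by
    by_cases h : x ≤ 3 / 4
    · simp only [hŵ, if_pos h]
      exact (e₁ ⟨le_of_lt hx, by linarith⟩).symm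
    · simp only [hŵ, if_neg h]
  have heqs₁ : EqOn ŝ ŝ₁ (Ioi (1 / 8)) := fun x hx => by
    by_cases h : x ≤ 3 / 4
    · simp only [hŝ, if_pos h]
      exact (e₂ ⟨le_of_lt hx, by linarith⟩).symm
    · simp only [hŝ, if_neg h]
  have gw₀ : ∀ x, x < 1 → ŵ =ᶠ[𝓝 x] ŵ₀ := fun x hx =>
    (heqw.mono Iio_subset_Iic_self).eventuallyEq_of_mem (Iio_mem_nhds hx)
  have gs₀ : ∀ x, x < 1 → ŝ =ᶠ[𝓝 x] ŝ₀ := fun x hx =>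
    (heqs.mono Iio_subset_Iic_self).eventuallyEq_of_mem (Iio_mem_nhds hx)
  have gw₁ : ∀ x, 1 / 8 < x → ŵ =ᶠ[𝓝 x] ŵ₁ := fun x hx => heqw₁.eventuallyEq_of_mem (Ioi_mem_nhds hx)
  have gs₁ : ∀ x, 1 / 8 < x → ŝ =ᶠ[𝓝 x] ŝ₁ := fun x hx => heqs₁.eventuallyEq_of_mem (Ioi_mem_nhds hx)
  have cŵ : ContDiff ℝ ∞ ŵ := contDiff_iff_contDiffAt.2 fun x => by
    rcases lt_or_ge x 1 with hx | hx
    · exact hŵ₀.contDiffAt.congr_of_eventuallyEq (gw₀ x hx)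
    · exact (sŵ₁.contDiffAt (hU.mem_nhds (show (1 / 8 : ℝ) < x by linarith))).congr_of_eventuallyEq
        (gw₁ x (by linarith))
  have cŝ : ContDiff ℝ ∞ ŝ := contDiff_iff_contDiffAt.2 fun x => by
    rcases lt_or_ge x 1 with hx | hx
    · exact hŝ₀.contDiffAt.congr_of_eventuallyEq (gs₀ x hx)
    · exact (sŝ₁.contDiffAt (hU.mem_nhds (show (1 / 8 : ℝ) < x by linarith))).congr_of_eventuallyEq
        (gs₁ x (by linarith))
  refine ⟨ŵ, ŝ, isRegularPair_of_eqOn ŵ₀ ŝ₀ ŵ ŝ 1 h₀ cŵ cŝ (heqw.mono Iio_subset_Iic_self)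
    (heqs.mono Iio_subset_Iic_self), fun x => ?_, heqw, heqs⟩
  rcases lt_or_ge x 1 with hx | hx
  · obtain ⟨h1, h2⟩ := lin_congr_of_eventuallyEq (r := r) (W := W) (S := S) (gw₀ x hx) (gs₀ x hx)
    rw [h1, h2, (gw₀ x hx).eq_of_nhds, (gs₀ x hx).eq_of_nhds]
    exact hsol x hx.le
  · have hx8 : 1 / 8 < x := by linarith
    obtain ⟨h1, h2⟩ := lin_congr_of_eventuallyEq (r := r) (W := W) (S := S) (gw₁ x hx8) (gs₁ x hx8)
    rw [h1, h2, (gw₁ x hx8).eq_of_nhds, (gs₁ x hx8).eq_of_nhds]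
    exact hsol₁ x hx8

end Summit.AtomisticToContinuum.HydrodynamicLimit.Theorems.SonicCavityRenewal

end
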